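import Summits.Langlands.Langlands.Theorems.SqrtFiveQuarticCoversBorelSevenX0SevenAlgebra

/-!
# Route `SqrtFiveQuarticCovers` (crux `RefinedLocusModular`, stmt-Langlands-17833): a Borel mod-`7` framing
# gives a `K`-point of `X₀(7)` over `j(E)` — `∃ u ∈ K, c₄³·u = (u²+13u+49)(u²+5u+1)³·Δ`

Galois wrapper of `…BorelSevenX0SevenAlgebra` (p801439), in the pattern of `…BorelFiveX0FiveHauptmodul`
(p800867).  The `b7`-binder of the route's cruxes and of RECORD v5's MODEL input `hK1w` (a framing
`ρ̄ : Γ_K →ₜ* GL₂(𝔽₇)` of `E[7]` with all `(1,0)` entries zero) yields the `X₀(7)`-conjunct of `hK1w`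
VERBATIM: `∃ u : K, c₄(E⊗K)³·u = (u²+13u+49)(u²+5u+1)³·Δ(E⊗K)`.

Steps: `P = e⁻¹(1,0)` has order `7` and `σ(x(P)) ∈ {x(P), x(2P), x(4P)}`; `order_seven_relations`
at `P` and at `2P`; the Tate coordinate `d = Ψ₃³/(P₄υ²)` transforms under `P ↦ 2P` by `d ↦ (d−1)/d`
(`tate_d_double`), under which `u = (d³−8d²+5d+1)/(d(d−1))` is invariant; Galois descent; the equation
from `exists_X0_seven_hauptmodul_of_relation`.  Everything is proved; no named fact; no `Δ ≠ 0` needed.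
HONEST STATUS: helper of stmt-Langlands-17833 (N1 debt: the `X₀(7)` factor of `hK1w` is now kernel;
the binder itself, bundled with level-`5` data, is unchanged); closes no stub; nothing here proves
modularity of any curve.

References: J. H. Silverman, GTM 106 (2009), III.§2, Ex. 3.7, I.§1; F. Klein (1878); [FreitasLeHungSiksek2015]
§2.2; J. Cremona–N. Freitas, *Global methods…*, §3.6.
-/

noncomputable section

set_option linter.dupNamespace false -- project-wide option (lakefile weak.linter.dupNamespace); `Summit.Langlands.Langlands` is the mandated namespace

open scoped Classical
open scoped Matrix NumberField

namespace Summit.Langlands.Langlands.Theorems.SqrtFiveQuarticCovers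

open WeierstrassCurve Literature.NumberTheory.GaloisRepresentations Polynomial

/-- **The Tate coordinate doubles by `d ↦ (d−1)/d`.**  Atoms at `x = x(P)` for a point with the
order-`7` relations (`τw − υ² = υ²(d−d²)`, `d·((τw−υ²)υ²) = w³`, `τ² + 4w = mυ`, `υ, w ≠ 0`,
`d ∉ {0,1}`) and the doubled atoms `T₂υ² = τυ² − mwυ + 6w²`, `U₂υ³ = (τw−υ²)²`,
`W₂υ⁴ = w((τw−υ²)υ² − w³ − (τw−υ²)²)` (the abscissa `x(2P)`): the Tate coordinate at `x(2P)`,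
`d₂·((T₂W₂ − U₂²)U₂²) = W₂³`, equals `(d − 1)/d` (the action of `[2]` on `X₁(7)`). [folklore] -/
theorem tate_d_double {L : Type*} [Field L] {τ w υ m d T₂ U₂ W₂ : L}
    (hυ : υ ≠ 0) (hw : w ≠ 0) (hd0 : d ≠ 0) (hd1 : d ≠ 1)
    (hRa : τ * w - υ ^ 2 = υ ^ 2 * (d - d ^ 2)) (hd : d * ((τ * w - υ ^ 2) * υ ^ 2) = w ^ 3)
    (hA3 : τ ^ 2 + 4 * w = m * υ)
    (hT : T₂ * υ ^ 2 = τ * υ ^ 2 - m * w * υ + 6 * w ^ 2)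
    (hU : U₂ * υ ^ 3 = (τ * w - υ ^ 2) ^ 2)
    (hW : W₂ * υ ^ 4 = w * ((τ * w - υ ^ 2) * υ ^ 2 - w ^ 3 - (τ * w - υ ^ 2) ^ 2)) :
    (T₂ * W₂ - U₂ ^ 2) * U₂ ^ 2 ≠ 0 ∧
      W₂ ^ 3 / ((T₂ * W₂ - U₂ ^ 2) * U₂ ^ 2) = (d - 1) / d := by
  have hw3 : w ^ 3 = d * (υ ^ 2 * (d - d ^ 2)) * υ ^ 2 := by rw [← hd, hRa]; ring
  have hτw : τ * w = υ ^ 2 * (d - d ^ 2) + υ ^ 2 := by linear_combination hRa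
  have hU' : U₂ * υ ^ 3 = (υ ^ 2 * (d - d ^ 2)) ^ 2 := by rw [hU, hRa]
  have hW' : W₂ * υ ^ 2 = w * υ ^ 2 * (d - d ^ 2) * (1 - d) ^ 2 := by
    apply mul_left_cancel₀ (pow_ne_zero 2 hυ)
    linear_combination hW + (w * (υ ^ 2 - (τ * w - υ ^ 2) - υ ^ 2 * (d - d ^ 2))) * hRa - w * hw3
  have hTw : T₂ * w * υ ^ 2 = υ ^ 4 * d * (1 - d) * (d ^ 2 + d - 1) := by
    linear_combination w * hT + w ^ 2 * hA3
      + (υ ^ 2 - τ * w - (υ ^ 2 * (d - d ^ 2) + υ ^ 2)) * hτw + 2 * hw3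
  have eL : w * υ ^ 12 * (W₂ ^ 3 * d) = d * w * (W₂ * υ ^ 2) ^ 3 * υ ^ 6 := by ring
  have eR : w * υ ^ 12 * ((d - 1) * ((T₂ * W₂ - U₂ ^ 2) * U₂ ^ 2)) =
      (d - 1) * ((T₂ * w * υ ^ 2) * (W₂ * υ ^ 2) * (U₂ * υ ^ 3) ^ 2 * υ ^ 2 - w * (U₂ * υ ^ 3) ^ 4) := by
    ring
  rw [hW'] at eL
  rw [hTw, hW', hU'] at eR
  have key : w * υ ^ 12 * (W₂ ^ 3 * d) = w * υ ^ 12 * ((d - 1) * ((T₂ * W₂ - U₂ ^ 2) * U₂ ^ 2)) := by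
    rw [eL, eR]
    linear_combination (d * w * υ ^ 12 * (d - d ^ 2) ^ 3 * (1 - d) ^ 6) * hw3
  have hwυ : w * υ ^ 12 ≠ 0 := mul_ne_zero hw (pow_ne_zero 12 hυ)
  have hW0 : W₂ ≠ 0 := by
    intro h0
    rw [h0, zero_mul, eq_comm] at hW'
    have : w * υ ^ 2 * (d - d ^ 2) * (1 - d) ^ 2 ≠ 0 := by
      have hdd : d - d ^ 2 ≠ 0 := by
        have : d - d ^ 2 = d * (1 - d) := by ring
        rw [this]; exact mul_ne_zero hd0 (sub_ne_zero.2 (Ne.symm hd1))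
      exact mul_ne_zero (mul_ne_zero (mul_ne_zero hw (pow_ne_zero 2 hυ)) hdd)
        (pow_ne_zero 2 (sub_ne_zero.2 (Ne.symm hd1)))
    exact this hW'
  have hD : (T₂ * W₂ - U₂ ^ 2) * U₂ ^ 2 ≠ 0 := by
    intro h0
    rw [h0, mul_zero, mul_zero] at key
    have : W₂ ^ 3 * d = 0 := (mul_eq_zero.1 key).resolve_left hwυ
    rcases mul_eq_zero.1 this with h | h
    · exact hW0 (pow_eq_zero_iff (n := 3) (by norm_num) |>.1 h)
    · exact hd0 h
  refine ⟨hD, ?_⟩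
  rw [div_eq_div_iff hD hd0]
  exact mul_left_cancel₀ hwυ (by linear_combination key)

/-- The `X₀(7)` hauptmodul `u(d) = (d³−8d²+5d+1)/(d(d−1))` is invariant under `d ↦ (d−1)/d`
(and `d ↦ 1/(1−d)`): the order-`3` automorphism of `X₁(7) → X₀(7)`. [folklore] -/
theorem X0_seven_u_cycle {L : Type*} [Field L] {d : L} (hd0 : d ≠ 0) (hd1 : d ≠ 1) :
    (((d - 1) / d) ^ 3 - 8 * ((d - 1) / d) ^ 2 + 5 * ((d - 1) / d) + 1)
        / (((d - 1) / d) * ((d - 1) / d - 1)) =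
      (d ^ 3 - 8 * d ^ 2 + 5 * d + 1) / (d * (d - 1)) := by
  have hd1' : d - 1 ≠ 0 := sub_ne_zero.2 hd1
  have e1 : ((d - 1) / d) ^ 3 - 8 * ((d - 1) / d) ^ 2 + 5 * ((d - 1) / d) + 1 =
      -(d ^ 3 - 8 * d ^ 2 + 5 * d + 1) / d ^ 3 := by
    field_simp
    ring
  have e2 : ((d - 1) / d) * ((d - 1) / d - 1) = -(d - 1) / d ^ 2 := by
    field_simp
    ring
  rw [e1, e2]
  field_simp

/-- **Invariance of the `X₀(7)` Tate coordinate under `P ↦ 2P`, at the level of abscissae.**  For an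
affine point `P = (x₁, y₁)` with `7P = O`: writing `d(z) := Ψ₃(z)³/(P₄(z)υ(z)²)`, one has
`d(x(2P)) = (d(x₁) − 1)/d(x₁)` where `x(2P) = addX x₁ x₁ (slope)`. [folklore] -/
theorem tate_d_addX_self {L : Type*} [Field L] (W : WeierstrassCurve L) {x₁ y₁ : L}
    (h₁ : W.toAffine.Nonsingular x₁ y₁)
    (h7 : (7 : ℕ) • (Affine.Point.some x₁ y₁ h₁ : W.toAffine.Point) = 0) :
    let x₂ := W.toAffine.addX x₁ x₁ (W.toAffine.slope x₁ x₁ y₁ y₁)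
    let dd : L → L := fun z =>
      (3 * z ^ 4 + W.b₂ * z ^ 3 + 3 * W.b₄ * z ^ 2 + 3 * W.b₆ * z + W.b₈) ^ 3 /
        (((6 * z ^ 2 + W.b₂ * z + W.b₄) * (3 * z ^ 4 + W.b₂ * z ^ 3 + 3 * W.b₄ * z ^ 2 + 3 * W.b₆ * z + W.b₈)
            - (4 * z ^ 3 + W.b₂ * z ^ 2 + 2 * W.b₄ * z + W.b₆) ^ 2)
          * (4 * z ^ 3 + W.b₂ * z ^ 2 + 2 * W.b₄ * z + W.b₆) ^ 2)
    dd x₁ ≠ 0 ∧ dd x₁ ≠ 1 ∧ dd x₂ = (dd x₁ - 1) / dd x₁ := by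
  intro x₂ dd
  obtain ⟨hy₁, hυ, hw, hP4, hR7⟩ := order_seven_relations W h₁ h7
  -- atoms at `x₁`
  obtain ⟨τ, hτ⟩ : ∃ τ : L, τ = 6 * x₁ ^ 2 + W.b₂ * x₁ + W.b₄ := ⟨_, rfl⟩
  obtain ⟨υ, hυd⟩ : ∃ υ : L, υ = 4 * x₁ ^ 3 + W.b₂ * x₁ ^ 2 + 2 * W.b₄ * x₁ + W.b₆ := ⟨_, rfl⟩
  obtain ⟨w, hwd⟩ : ∃ w : L, w = 3 * x₁ ^ 4 + W.b₂ * x₁ ^ 3 + 3 * W.b₄ * x₁ ^ 2 + 3 * W.b₆ * x₁ + W.b₈ :=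
    ⟨_, rfl⟩
  obtain ⟨d, hdd⟩ : ∃ d : L, d = dd x₁ := ⟨_, rfl⟩
  have hddef : d = w ^ 3 / ((τ * w - υ ^ 2) * υ ^ 2) := by rw [hdd]; show _ = _; rw [hτ, hυd, hwd]
  rw [← hτ] at hP4 hR7
  rw [← hυd] at hυ hP4 hR7
  rw [← hwd] at hw hP4 hR7
  have hden : (τ * w - υ ^ 2) * υ ^ 2 ≠ 0 := mul_ne_zero hP4 (pow_ne_zero 2 hυ)
  have hdmul : d * ((τ * w - υ ^ 2) * υ ^ 2) = w ^ 3 := by rw [hddef, div_mul_cancel₀ _ hden]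
  have hmain := exists_X0_seven_hauptmodul_of_relation W (x := x₁) (d := d)
    (by rw [← hυd]; exact hυ) (by rw [← hwd]; exact hw) (by rw [← hτ, ← hυd, ← hwd]; exact hP4)
    (by rw [← hτ, ← hυd, ← hwd]; exact hR7) (by rw [← hτ, ← hυd, ← hwd]; exact hdmul)
  obtain ⟨hd0, hd1, -⟩ := hmain
  -- `P₄ = υ²(d − d²)` from `R₇`
  have hRa : τ * w - υ ^ 2 = υ ^ 2 * (d - d ^ 2) := by
    have key : ((τ * w - υ ^ 2) * υ) ^ 2 * ((τ * w - υ ^ 2) - υ ^ 2 * (d - d ^ 2)) = 0 := by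
      have hw3 : w ^ 3 = d * ((τ * w - υ ^ 2) * υ ^ 2) := hdmul.symm
      linear_combination hR7
        + ((τ * w - υ ^ 2) * υ ^ 2 - d * ((τ * w - υ ^ 2) * υ ^ 2) - w ^ 3) * hw3
    exact sub_eq_zero.1 ((mul_eq_zero.1 key).resolve_left (pow_ne_zero 2 (mul_ne_zero hP4 hυ)))
  -- the doubled atoms
  have hX2 : x₂ * υ = x₁ * υ - w := by
    show W.toAffine.addX x₁ x₁ (W.toAffine.slope x₁ x₁ y₁ y₁) * υ = _
    rw [hυd, hwd]; exact addX_self_mul_upsilon W h₁.left hy₁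
  obtain ⟨τ₂, hτ₂⟩ : ∃ τ₂ : L, τ₂ = 6 * x₂ ^ 2 + W.b₂ * x₂ + W.b₄ := ⟨_, rfl⟩
  obtain ⟨υ₂, hυ₂⟩ : ∃ υ₂ : L, υ₂ = 4 * x₂ ^ 3 + W.b₂ * x₂ ^ 2 + 2 * W.b₄ * x₂ + W.b₆ := ⟨_, rfl⟩
  obtain ⟨w₂, hw₂⟩ : ∃ w₂ : L, w₂ = 3 * x₂ ^ 4 + W.b₂ * x₂ ^ 3 + 3 * W.b₄ * x₂ ^ 2 + 3 * W.b₆ * x₂ + W.b₈ :=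
    ⟨_, rfl⟩
  have hT2 : τ₂ * υ ^ 2 = τ * υ ^ 2 - (12 * x₁ + W.b₂) * w * υ + 6 * w ^ 2 := by
    have : τ₂ * υ ^ 2 = 6 * (x₂ * υ) ^ 2 + W.b₂ * (x₂ * υ) * υ + W.b₄ * υ ^ 2 := by rw [hτ₂]; ring
    rw [this, hX2, hτ]; ring
  have hU2 : υ₂ * υ ^ 3 = (τ * w - υ ^ 2) ^ 2 := by
    have u3 := upsilon_double W x₁
    rw [← hτ, ← hυd, ← hwd, ← hX2] at u3
    rw [hυ₂]
    linear_combination u3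
  have hW2 : w₂ * υ ^ 4 = w * ((τ * w - υ ^ 2) * υ ^ 2 - w ^ 3 - (τ * w - υ ^ 2) ^ 2) := by
    have u4 := Ψ₃_double W x₁
    rw [← hτ, ← hυd, ← hwd, ← hX2] at u4
    rw [hw₂]
    linear_combination u4
  have hA3 := tau_sq_add_four_Ψ₃ W x₁
  rw [← hτ, ← hυd, ← hwd] at hA3
  -- the Tate coordinate at `x₂`
  obtain ⟨d₂, hd₂d⟩ : ∃ d₂ : L, d₂ = dd x₂ := ⟨_, rfl⟩
  have hd₂def : d₂ = w₂ ^ 3 / ((τ₂ * w₂ - υ₂ ^ 2) * υ₂ ^ 2) := by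
    rw [hd₂d]; show _ = _; rw [hτ₂, hυ₂, hw₂]
  refine ⟨by rw [← hdd]; exact hd0, by rw [← hdd]; exact hd1, ?_⟩
  rw [← hdd, ← hd₂d, hd₂def]
  exact (tate_d_double hυ hw hd0 hd1 hRa hdmul hA3 hT2 hU2 hW2).2

/-- **A Borel mod-`7` framing gives a `K`-point of `X₀(7)` over `j`.**  Let `K` be a perfect field,
`V` a Weierstrass curve over `K`, `ρ̄ : Γ_K →ₜ* GL₂(𝔽₇)` with an equivariant framing
`e : V[7](K̄) ≃+ 𝔽₇²` and all `(1,0)` entries zero.  Then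
`∃ u : K, c₄(V)³·u = (u² + 13u + 49)(u² + 5u + 1)³·Δ(V)` — `j(V) = (u²+13u+49)(u²+5u+1)³/u` is the image
of a `K`-point of `X₀(7)`.  Proof: `P = e⁻¹(1,0)` has order `7`, `σ(x(P)) ∈ {x(P), x(2P), x(4P)}`;
`tate_d_addX_self` at `P` and `2P` + `X0_seven_u_cycle` make `u(x(P))` Galois-invariant;
`exists_X0_seven_hauptmodul_of_relation` gives the equation.
[cite: SilvermanAEC2009, III.§2, Ex. 3.7, I.§1] [cite: FreitasLeHungSiksek2015, §2.2] -/
theorem exists_X0_seven_hauptmodul_of_borelSeven {K : Type} [Field K] [PerfectField K]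
    (V : WeierstrassCurve K) (ρ : FramedGaloisRep K (ZMod 7) 2)
    (e : V.geomTorsion ((7 : ℕ) : ℤ) ≃+ (Fin 2 → ZMod 7))
    (he : ∀ (σ : Field.absoluteGaloisGroup K) (P : V.geomTorsion ((7 : ℕ) : ℤ)),
      e (σ • P) = ((ρ σ : GL (Fin 2) (ZMod 7)) : Matrix (Fin 2) (Fin 2) (ZMod 7)) *ᵥ (e P))
    (hB : ∀ σ : Field.absoluteGaloisGroup K,
      (((ρ σ : GL (Fin 2) (ZMod 7)) : Matrix (Fin 2) (Fin 2) (ZMod 7)) 1 0 = 0)) :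
    ∃ u : K, V.c₄ ^ 3 * u = (u ^ 2 + 13 * u + 49) * (u ^ 2 + 5 * u + 1) ^ 3 * V.Δ := by
  have d0 : ∀ b : ZMod 7, b = 0 ∨ b = 1 ∨ b = 2 ∨ b = 3 ∨ b = 4 ∨ b = 5 ∨ b = 6 := by decide
  have d2 : ∀ c : ZMod 7, (2 : ZMod 7) * c = c + c := by decide
  have d3 : ∀ c : ZMod 7, (3 : ZMod 7) * c = -((c + c) + (c + c)) := by decide
  have d4 : ∀ c : ZMod 7, (4 : ZMod 7) * c = (c + c) + (c + c) := by decide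
  have d5 : ∀ c : ZMod 7, (5 : ZMod 7) * c = -(c + c) := by decide
  have d6 : ∀ c : ZMod 7, (6 : ZMod 7) * c = -c := by decide
  haveI : IsGalois K (AlgebraicClosure K) := {}
  set L := AlgebraicClosure K with hL
  have inj : Function.Injective (algebraMap K L) := (algebraMap K L).injective
  set W := V.baseChange L with hWdef
  have hb₂ : W.b₂ = algebraMap K L V.b₂ := by rw [hWdef, WeierstrassCurve.baseChange, WeierstrassCurve.map_b₂]
  have hb₄ : W.b₄ = algebraMap K L V.b₄ := by rw [hWdef, WeierstrassCurve.baseChange, WeierstrassCurve.map_b₄]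
  have hb₆ : W.b₆ = algebraMap K L V.b₆ := by rw [hWdef, WeierstrassCurve.baseChange, WeierstrassCurve.map_b₆]
  have hb₈ : W.b₈ = algebraMap K L V.b₈ := by rw [hWdef, WeierstrassCurve.baseChange, WeierstrassCurve.map_b₈]
  have hc₄ : W.c₄ = algebraMap K L V.c₄ := by rw [hWdef, WeierstrassCurve.baseChange, WeierstrassCurve.map_c₄]
  have hΔ' : W.Δ = algebraMap K L V.Δ := by rw [hWdef, WeierstrassCurve.baseChange, WeierstrassCurve.map_Δ]
  -- the framed point
  set v : Fin 2 → ZMod 7 := Pi.single 0 1 with hv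
  set P : V.geomTorsion ((7 : ℕ) : ℤ) := e.symm v with hPdef
  have heP : e P = v := e.apply_symm_apply v
  have hv0 : v ≠ 0 := by
    intro h; have := congrFun h 0; simp [hv] at this; exact absurd this (by decide)
  have hP0 : P ≠ 0 := by
    intro h; apply hv0; rw [← heP, h, map_zero]
  -- `σ • P ∈ {±P, ±2P, ±4P}`
  have hσ : ∀ σ : Field.absoluteGaloisGroup K,
      σ • P = P ∨ σ • P = -P ∨ σ • P = P + P ∨ σ • P = -(P + P) ∨
        σ • P = (P + P) + (P + P) ∨ σ • P = -((P + P) + (P + P)) := by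
    intro σ
    have h1 : e (σ • P) = (((ρ σ : GL (Fin 2) (ZMod 7)) : Matrix (Fin 2) (Fin 2) (ZMod 7)) 0 0) • v := by
      rw [he, heP]
      ext i
      fin_cases i
      · simp [hv, Matrix.mulVec, dotProduct, Fin.sum_univ_two]
      · simp [hv, Matrix.mulVec, dotProduct, Fin.sum_univ_two, hB σ]
    generalize ha : (((ρ σ : GL (Fin 2) (ZMod 7)) : Matrix (Fin 2) (Fin 2) (ZMod 7)) 0 0) = a at h1
    rcases d0 a with h0 | h1' | h2 | h3 | h4 | h5 | h6
    · exfalso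
      rw [h0, zero_smul] at h1
      have : σ • P = 0 := by apply e.injective; rw [h1, map_zero]
      exact hP0 ((smul_eq_zero_iff_eq σ).1 this)
    · left; apply e.injective; rw [h1, h1', one_smul, heP]
    · right; right; left
      apply e.injective
      rw [h1, map_add, heP, h2]
      ext i; simp only [Pi.smul_apply, smul_eq_mul, Pi.add_apply]; exact d2 (v i)
    · right; right; right; right; right
      apply e.injective
      rw [h1, map_neg, map_add, map_add, heP, h3]
      ext i; simp only [Pi.smul_apply, smul_eq_mul, Pi.neg_apply, Pi.add_apply]; exact d3 (v i)
    · right; right; right; right; left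
      apply e.injective
      rw [h1, map_add, map_add, heP, h4]
      ext i; simp only [Pi.smul_apply, smul_eq_mul, Pi.add_apply]; exact d4 (v i)
    · right; right; right; left
      apply e.injective
      rw [h1, map_neg, map_add, heP, h5]
      ext i; simp only [Pi.smul_apply, smul_eq_mul, Pi.neg_apply, Pi.add_apply]; exact d5 (v i)
    · right; left
      apply e.injective
      rw [h1, map_neg, heP, h6]
      ext i; simp only [Pi.smul_apply, smul_eq_mul, Pi.neg_apply]; exact d6 (v i)
  -- the underlying point
  obtain ⟨Q, hQ⟩ : ∃ Q : W.toAffine.Point, Q = (P : V.geomPoints) := ⟨_, rfl⟩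
  have hQ0 : Q ≠ 0 := by
    intro h; apply hP0; apply Subtype.ext; rw [← hQ]; exact h
  have hQ7 : (7 : ℕ) • Q = 0 := by
    rw [hQ, ← natCast_zsmul]
    exact (Submodule.mem_torsionBy_iff _ _).1 P.2
  have hσQ : ∀ σ : AlgebraicClosure K ≃ₐ[K] AlgebraicClosure K,
      σ • Q = Q ∨ σ • Q = -Q ∨ σ • Q = Q + Q ∨ σ • Q = -(Q + Q) ∨
        σ • Q = (Q + Q) + (Q + Q) ∨ σ • Q = -((Q + Q) + (Q + Q)) := by
    intro σ
    rw [hQ]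
    rcases hσ σ with h | h | h | h | h | h
    · exact Or.inl (congrArg (fun T : V.geomTorsion ((7 : ℕ) : ℤ) => (T : V.geomPoints)) h)
    · exact Or.inr (Or.inl (congrArg (fun T : V.geomTorsion ((7 : ℕ) : ℤ) => (T : V.geomPoints)) h))
    · exact Or.inr (Or.inr (Or.inl
        (congrArg (fun T : V.geomTorsion ((7 : ℕ) : ℤ) => (T : V.geomPoints)) h)))
    · exact Or.inr (Or.inr (Or.inr (Or.inl
        (congrArg (fun T : V.geomTorsion ((7 : ℕ) : ℤ) => (T : V.geomPoints)) h))))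
    · exact Or.inr (Or.inr (Or.inr (Or.inr (Or.inl
        (congrArg (fun T : V.geomTorsion ((7 : ℕ) : ℤ) => (T : V.geomPoints)) h)))))
    · exact Or.inr (Or.inr (Or.inr (Or.inr (Or.inr
        (congrArg (fun T : V.geomTorsion ((7 : ℕ) : ℤ) => (T : V.geomPoints)) h)))))
  clear hσ hQ
  rcases Q with _ | ⟨x₁, y₁, h₁⟩
  · exact absurd rfl hQ0
  -- order-`7` data at `P` and `2P`
  obtain ⟨hy₁, hυ₁, hw₁, hP4₁, hR7₁⟩ := order_seven_relations W h₁ hQ7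
  have h2Q := Affine.Point.add_self_of_Y_ne (h₁ := h₁) hy₁
  obtain ⟨x₂, hx₂⟩ : ∃ x₂ : L, x₂ = W.toAffine.addX x₁ x₁ (W.toAffine.slope x₁ x₁ y₁ y₁) := ⟨_, rfl⟩
  obtain ⟨y₂, hy₂d⟩ : ∃ y₂ : L, y₂ = W.toAffine.addY x₁ x₁ y₁ (W.toAffine.slope x₁ x₁ y₁ y₁) := ⟨_, rfl⟩
  have h₂ : W.toAffine.Nonsingular x₂ y₂ := by
    rw [hx₂, hy₂d]; exact Affine.nonsingular_add h₁ h₁ fun hxy => hy₁ hxy.right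
  have h2Q' : (Affine.Point.some x₁ y₁ h₁ : W.toAffine.Point) + Affine.Point.some x₁ y₁ h₁ =
      Affine.Point.some x₂ y₂ h₂ := by
    rw [h2Q]; simp only [hx₂, hy₂d]
  have h2Q7 : (7 : ℕ) • (Affine.Point.some x₂ y₂ h₂ : W.toAffine.Point) = 0 := by
    rw [← h2Q', ← two_nsmul, smul_smul, mul_comm, ← smul_smul, hQ7, nsmul_zero]
  obtain ⟨hy₂, -, -, -, -⟩ := order_seven_relations W h₂ h2Q7
  have h4Q := Affine.Point.add_self_of_Y_ne (h₁ := h₂) hy₂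
  obtain ⟨x₄, hx₄⟩ : ∃ x₄ : L, x₄ = W.toAffine.addX x₂ x₂ (W.toAffine.slope x₂ x₂ y₂ y₂) := ⟨_, rfl⟩
  obtain ⟨y₄, hy₄d⟩ : ∃ y₄ : L, y₄ = W.toAffine.addY x₂ x₂ y₂ (W.toAffine.slope x₂ x₂ y₂ y₂) := ⟨_, rfl⟩
  have h₄ : W.toAffine.Nonsingular x₄ y₄ := by
    rw [hx₄, hy₄d]; exact Affine.nonsingular_add h₂ h₂ fun hxy => hy₂ hxy.right
  have h4Q' : (Affine.Point.some x₂ y₂ h₂ : W.toAffine.Point) + Affine.Point.some x₂ y₂ h₂ =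
      Affine.Point.some x₄ y₄ h₄ := by
    rw [h4Q]; simp only [hx₄, hy₄d]
  -- Tate coordinates
  obtain ⟨hd0, hd1, hd₂⟩ := tate_d_addX_self W h₁ hQ7
  obtain ⟨hd0', hd1', hd₄⟩ := tate_d_addX_self W h₂ h2Q7
  rw [← hx₂] at hd₂
  rw [← hx₄] at hd₄
  -- `u` as a function of the abscissa
  set dd : L → L := fun z =>
      (3 * z ^ 4 + W.b₂ * z ^ 3 + 3 * W.b₄ * z ^ 2 + 3 * W.b₆ * z + W.b₈) ^ 3 /
        (((6 * z ^ 2 + W.b₂ * z + W.b₄) * (3 * z ^ 4 + W.b₂ * z ^ 3 + 3 * W.b₄ * z ^ 2 + 3 * W.b₆ * z + W.b₈)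
            - (4 * z ^ 3 + W.b₂ * z ^ 2 + 2 * W.b₄ * z + W.b₆) ^ 2)
          * (4 * z ^ 3 + W.b₂ * z ^ 2 + 2 * W.b₄ * z + W.b₆) ^ 2) with hdddef
  set uu : L → L := fun t => (t ^ 3 - 8 * t ^ 2 + 5 * t + 1) / (t * (t - 1)) with huudef
  have hu₂ : uu (dd x₂) = uu (dd x₁) := by
    show (dd x₂ ^ 3 - 8 * dd x₂ ^ 2 + 5 * dd x₂ + 1) / (dd x₂ * (dd x₂ - 1)) =
      (dd x₁ ^ 3 - 8 * dd x₁ ^ 2 + 5 * dd x₁ + 1) / (dd x₁ * (dd x₁ - 1))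
    rw [hd₂]; exact X0_seven_u_cycle hd0 hd1
  have hu₄ : uu (dd x₄) = uu (dd x₂) := by
    show (dd x₄ ^ 3 - 8 * dd x₄ ^ 2 + 5 * dd x₄ + 1) / (dd x₄ * (dd x₄ - 1)) =
      (dd x₂ ^ 3 - 8 * dd x₂ ^ 2 + 5 * dd x₂ + 1) / (dd x₂ * (dd x₂ - 1))
    rw [hd₄]; exact X0_seven_u_cycle hd0' hd1'
  -- the equation in `L`
  have hden : ((6 * x₁ ^ 2 + W.b₂ * x₁ + W.b₄)
        * (3 * x₁ ^ 4 + W.b₂ * x₁ ^ 3 + 3 * W.b₄ * x₁ ^ 2 + 3 * W.b₆ * x₁ + W.b₈)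
      - (4 * x₁ ^ 3 + W.b₂ * x₁ ^ 2 + 2 * W.b₄ * x₁ + W.b₆) ^ 2)
      * (4 * x₁ ^ 3 + W.b₂ * x₁ ^ 2 + 2 * W.b₄ * x₁ + W.b₆) ^ 2 ≠ 0 :=
    mul_ne_zero hP4₁ (pow_ne_zero 2 hυ₁)
  have hdmul : dd x₁ * (((6 * x₁ ^ 2 + W.b₂ * x₁ + W.b₄)
        * (3 * x₁ ^ 4 + W.b₂ * x₁ ^ 3 + 3 * W.b₄ * x₁ ^ 2 + 3 * W.b₆ * x₁ + W.b₈)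
      - (4 * x₁ ^ 3 + W.b₂ * x₁ ^ 2 + 2 * W.b₄ * x₁ + W.b₆) ^ 2)
      * (4 * x₁ ^ 3 + W.b₂ * x₁ ^ 2 + 2 * W.b₄ * x₁ + W.b₆) ^ 2) =
      (3 * x₁ ^ 4 + W.b₂ * x₁ ^ 3 + 3 * W.b₄ * x₁ ^ 2 + 3 * W.b₆ * x₁ + W.b₈) ^ 3 := by
    show _ / _ * _ = _
    exact div_mul_cancel₀ _ hden
  obtain ⟨-, -, hLeq⟩ := exists_X0_seven_hauptmodul_of_relation W hυ₁ hw₁ hP4₁ hR7₁ hdmul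
  -- Galois descent
  have hfix : ∀ σ : AlgebraicClosure K ≃ₐ[K] AlgebraicClosure K, σ (uu (dd x₁)) = uu (dd x₁) := by
    intro σ
    have hσb₂ : σ W.b₂ = W.b₂ := by rw [hb₂]; exact σ.commutes _
    have hσb₄ : σ W.b₄ = W.b₄ := by rw [hb₄]; exact σ.commutes _
    have hσb₆ : σ W.b₆ = W.b₆ := by rw [hb₆]; exact σ.commutes _
    have hσb₈ : σ W.b₈ = W.b₈ := by rw [hb₈]; exact σ.commutes _
    have hx : σ x₁ = x₁ ∨ σ x₁ = x₂ ∨ σ x₁ = x₄ := by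
      rcases hσQ σ with h | h | h | h | h | h
      · left; rw [WeierstrassCurve.smul_def, Affine.Point.map_some] at h
        exact (Affine.Point.some.inj h).1
      · left; rw [WeierstrassCurve.smul_def, Affine.Point.map_some, Affine.Point.neg_some] at h
        exact (Affine.Point.some.inj h).1
      · right; left; rw [WeierstrassCurve.smul_def, Affine.Point.map_some, h2Q'] at h
        exact (Affine.Point.some.inj h).1
      · right; left
        rw [WeierstrassCurve.smul_def, Affine.Point.map_some, h2Q', Affine.Point.neg_some] at h
        exact (Affine.Point.some.inj h).1
      · right; right; rw [WeierstrassCurve.smul_def, Affine.Point.map_some, h2Q', h4Q'] at h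
        exact (Affine.Point.some.inj h).1
      · right; right
        rw [WeierstrassCurve.smul_def, Affine.Point.map_some, h2Q', h4Q', Affine.Point.neg_some] at h
        exact (Affine.Point.some.inj h).1
    have push : ∀ z : L, σ (uu (dd z)) = uu (dd (σ z)) := by
      intro z
      simp only [huudef, hdddef, map_div₀, map_mul, map_sub, map_add, map_pow, map_ofNat, map_one,
        hσb₂, hσb₄, hσb₆, hσb₈]
    rw [push]
    rcases hx with hx | hx | hx
    · rw [hx]
    · rw [hx, hu₂]
    · rw [hx, hu₄, hu₂]
  obtain ⟨u₀, hu₀⟩ := (InfiniteGalois.mem_range_algebraMap_iff_fixed (uu (dd x₁))).mpr hfix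
  refine ⟨u₀, ?_⟩
  apply inj
  have hLeq' : W.c₄ ^ 3 * uu (dd x₁) = (uu (dd x₁) ^ 2 + 13 * uu (dd x₁) + 49)
      * (uu (dd x₁) ^ 2 + 5 * uu (dd x₁) + 1) ^ 3 * W.Δ := hLeq
  rw [← hu₀, hc₄, hΔ'] at hLeq'
  simpa only [map_mul, map_pow, map_add, map_ofNat, map_one] using hLeq'

/-- **The `b7`-binder of the route's cruxes gives the `X₀(7)`-conjunct of RECORD v5's `hK1w`.**  For a
number field `K`, `E / 𝓞 K`, and a framing of `E[7]` with all `(1,0)` entries zero (VERBATIM the `b7`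
disjunct of `RefinedLocusModular` / `BoxBorelFive` and the `b7` hypothesis of the MODEL input `hK1w`):
`∃ u : K, c₄(E⊗K)³·u = (u² + 13u + 49)(u² + 5u + 1)³·Δ(E⊗K)` — `j(E) = (u²+13u+49)(u²+5u+1)³/u`,
a `K`-point of `X₀(7)` over `j(E)`.  Proof: `exists_X0_seven_hauptmodul_of_borelSeven`.
[cite: FreitasLeHungSiksek2015, §2.2] [cite: SilvermanAEC2009, Ex. 3.7] -/
theorem exists_X0_seven_hauptmodul_of_borelSeven_framing (K : Type) [Field K] [NumberField K]
    (E : WeierstrassCurve (𝓞 K))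
    (h7 : ∃ ρ : Literature.NumberTheory.GaloisRepresentations.FramedGaloisRep K (ZMod 7) 2,
      (∃ e : (E.baseChange K).geomTorsion ((7 : ℕ) : ℤ) ≃+ (Fin 2 → ZMod 7),
        ∀ (σ : Field.absoluteGaloisGroup K) (P : (E.baseChange K).geomTorsion ((7 : ℕ) : ℤ)),
          e (σ • P) = ((ρ σ : GL (Fin 2) (ZMod 7)) : Matrix (Fin 2) (Fin 2) (ZMod 7)) *ᵥ (e P)) ∧
      (∀ σ : Field.absoluteGaloisGroup K,
        (((ρ σ : GL (Fin 2) (ZMod 7)) : Matrix (Fin 2) (Fin 2) (ZMod 7)) 1 0 = 0))) :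
    ∃ u : K, (E.baseChange K).c₄ ^ 3 * u = (u ^ 2 + 13 * u + 49) * (u ^ 2 + 5 * u + 1) ^ 3 * (E.baseChange K).Δ := by
  obtain ⟨ρ, ⟨e, he⟩, hB⟩ := h7
  exact exists_X0_seven_hauptmodul_of_borelSeven (E.baseChange K) ρ e he hB

end Summit.Langlands.Langlands.Theorems.SqrtFiveQuarticCovers

end
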